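import Mathlib

/-!
# `ExactCertificate` (stmt-AtomisticToContinuum-11959), line `closure-makes-nogap-exact`,
# Transfer skeleton II (`Cruxes.ExactCertificate.Transfer1D.Crystallization1D`): stub `stub_blockMatching`

Support file for the crux `ThreeConeCertificate.ExactCertificate` (crux 11959), line
`closure-makes-nogap-exact`, TRANSFER skeleton II `Crystallization1D` (crystallization of the
Lennard-Jones chain, `d = 1`).  This file proves the registered stub `stub_blockMatching`, a piece
of pure real / natural-number arithmetic (telescoping sums) turning GAP information about the
sorted positions `y 0, y 1, …, y (N-1)` of a ground state into POSITION information relative to a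
centre particle `c`:

* if every nearest-neighbour gap is `≥ 3/4`, then `|y i - y c| ≥ (3/4) |i - c|` for all `i < N`;
* if on the central block of gaps with indices in `[c - M, c + M)` every gap is within `ε` of the
  lattice constant `a`, then `|y i - y c - (i - c) a| ≤ M ε` for `c - M ≤ i ≤ c + M`.

Proof: `y (p + k) - y p = Σ_{l<k} (y (p+l+1) - y (p+l))` (induction on `k`); termwise bounds are
summed, and one splits on `c ≤ i` (write `i = c + k`) versus `i < c` (write `c = i + k`).
All `[folklore]`.
-/

noncomputable section

namespace Summit.AtomisticToContinuum.Crystallization.Theorems.ThreeConeCertificateExactCertificate.Transfer1D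

/-- Telescoping: `y (p + k) - y p = Σ_{l<k} (y (p+l+1) - y (p+l))`. [folklore] -/
theorem blockMatching_telescope (y : ℕ → ℝ) (p k : ℕ) :
    y (p + k) - y p = ∑ l ∈ Finset.range k, (y (p + l + 1) - y (p + l)) := by
  induction k with
  | zero => simp
  | succ k ih =>
    rw [Finset.sum_range_succ, ← ih]
    show y (p + k + 1) - y p = _
    ring

/-- Summing termwise lower bounds along a telescope: if each of the `k` consecutive gaps starting
at `p` is `≥ 3/4`, then `y (p + k) - y p ≥ (3/4) k`. [folklore] -/
theorem blockMatching_lower (y : ℕ → ℝ) (p k : ℕ)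
    (h : ∀ l : ℕ, l < k → 3 / 4 ≤ y (p + l + 1) - y (p + l)) :
    3 / 4 * (k : ℝ) ≤ y (p + k) - y p := by
  rw [blockMatching_telescope]
  have hc : 3 / 4 * (k : ℝ) = ∑ _l ∈ Finset.range k, (3 / 4 : ℝ) := by
    rw [Finset.sum_const, Finset.card_range, nsmul_eq_mul]
    ring
  rw [hc]
  exact Finset.sum_le_sum fun l hl => h l (Finset.mem_range.mp hl)

/-- Summing termwise closeness along a telescope: if each of the `k` consecutive gaps starting at
`p` is within `ε` of `a`, then `|y (p + k) - y p - k a| ≤ k ε`. [folklore] -/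
theorem blockMatching_upper (y : ℕ → ℝ) (a ε : ℝ) (p k : ℕ)
    (h : ∀ l : ℕ, l < k → |y (p + l + 1) - y (p + l) - a| ≤ ε) :
    |y (p + k) - y p - (k : ℝ) * a| ≤ (k : ℝ) * ε := by
  have hk : y (p + k) - y p - (k : ℝ) * a
      = ∑ l ∈ Finset.range k, (y (p + l + 1) - y (p + l) - a) := by
    rw [Finset.sum_sub_distrib, ← blockMatching_telescope, Finset.sum_const, Finset.card_range,
      nsmul_eq_mul]
  rw [hk]
  calc |∑ l ∈ Finset.range k, (y (p + l + 1) - y (p + l) - a)|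
      ≤ ∑ l ∈ Finset.range k, |y (p + l + 1) - y (p + l) - a| := Finset.abs_sum_le_sum_abs _ _
    _ ≤ ∑ _l ∈ Finset.range k, ε := Finset.sum_le_sum fun l hl => h l (Finset.mem_range.mp hl)
    _ = (k : ℝ) * ε := by rw [Finset.sum_const, Finset.card_range, nsmul_eq_mul]

/-- **Registered stub `stub_blockMatching`** — FROM GAPS TO POSITIONS (telescoping): gaps `≥ 3/4`
give `|y i - y c| ≥ (3/4) |i - c|` for all `i < N`; gaps within `ε` of `a` on the block of gap
indices `[c - M, c + M)` give `|y i - y c - (i - c) a| ≤ M ε` for `c - M ≤ i ≤ c + M`. [folklore] -/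
theorem stub_blockMatching : ∀ (N c M : ℕ) (y : ℕ → ℝ) (a ε : ℝ),
    (∀ i : ℕ, i + 1 < N → 3 / 4 ≤ y (i + 1) - y i) →
    (∀ i : ℕ, c - M ≤ i → i < c + M → |y (i + 1) - y i - a| ≤ ε) →
    M ≤ c → c + M < N → 0 ≤ ε →
    (∀ i : ℕ, i < N → 3 / 4 * |(i : ℝ) - c| ≤ |y i - y c|) ∧
    (∀ i : ℕ, c - M ≤ i → i ≤ c + M → |y i - y c - ((i : ℝ) - c) * a| ≤ M * ε) := by
  intro N c M y a ε hgap hblock hMc hcMN hε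
  refine ⟨fun i hi => ?_, fun i hi1 hi2 => ?_⟩
  · rcases le_or_gt c i with hci | hic
    · -- `i = c + k`: telescope upwards from `c`.
      obtain ⟨k, rfl⟩ := Nat.exists_eq_add_of_le hci
      have hlow : 3 / 4 * (k : ℝ) ≤ y (c + k) - y c :=
        blockMatching_lower y c k fun l hl => hgap (c + l) (by omega)
      have e1 : ((c + k : ℕ) : ℝ) - (c : ℝ) = k := by
        push_cast
        ring
      rw [e1, abs_of_nonneg (Nat.cast_nonneg k), abs_of_nonneg (le_trans (by positivity) hlow)]
      exact hlow
    · -- `c = i + k`: telescope upwards from `i`.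
      obtain ⟨k, hk⟩ := Nat.exists_eq_add_of_le hic.le
      subst hk
      have hlow : 3 / 4 * (k : ℝ) ≤ y (i + k) - y i :=
        blockMatching_lower y i k fun l hl => hgap (i + l) (by omega)
      have e1 : (i : ℝ) - ((i + k : ℕ) : ℝ) = -(k : ℝ) := by
        push_cast
        ring
      rw [e1, abs_neg, abs_of_nonneg (Nat.cast_nonneg k), abs_sub_comm,
        abs_of_nonneg (le_trans (by positivity) hlow)]
      exact hlow
  · rcases le_or_gt c i with hci | hic
    · -- `i = c + k` with `k ≤ M`: the gaps `c, …, c + k - 1` lie in the good block.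
      obtain ⟨k, rfl⟩ := Nat.exists_eq_add_of_le hci
      have hkM : (k : ℝ) ≤ M := by exact_mod_cast (by omega : k ≤ M)
      have hup : |y (c + k) - y c - (k : ℝ) * a| ≤ (k : ℝ) * ε :=
        blockMatching_upper y a ε c k fun l hl => hblock (c + l) (by omega) (by omega)
      have e1 : ((c + k : ℕ) : ℝ) - (c : ℝ) = k := by
        push_cast
        ring
      rw [e1]
      exact hup.trans (mul_le_mul_of_nonneg_right hkM hε)
    · -- `c = i + k` with `k ≤ M`: the gaps `i, …, c - 1` lie in the good block.
      obtain ⟨k, hk⟩ := Nat.exists_eq_add_of_le hic.le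
      subst hk
      have hkM : (k : ℝ) ≤ M := by exact_mod_cast (by omega : k ≤ M)
      have hup : |y (i + k) - y i - (k : ℝ) * a| ≤ (k : ℝ) * ε :=
        blockMatching_upper y a ε i k fun l hl => hblock (i + l) (by omega) (by omega)
      have e1 : y i - y (i + k) - ((i : ℝ) - ((i + k : ℕ) : ℝ)) * a
          = -(y (i + k) - y i - (k : ℝ) * a) := by
        push_cast
        ring
      rw [e1, abs_neg]
      exact hup.trans (mul_le_mul_of_nonneg_right hkM hε)

end Summit.AtomisticToContinuum.Crystallization.Theorems.ThreeConeCertificateExactCertificate.Transfer1D
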